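import Summits.CriticalPhenomena.SAWScalingLimit.Theorems.SAWDefectDecoherenceBoundaryClosureRBoundaryReachOfConnected
import Summits.CriticalPhenomena.SAWScalingLimit.Theorems.SAWDevelopingMapPotentialExistsTopology
import HarnessLib

/-!
# Boundary bookkeeping, VII: the boundary-site graph of a simply connected, connected domain is connected

Route `SAWDefectDecoherence`, crux `BoundaryClosureR` (stmt-CriticalPhenomena-14004), line
`pick-half-plane`, wave 6, serving `stub_halfPlaneInputs`: the registered sub-goal
`stub_halfPlaneInputs_boundarySiteGraphConnected` = the conjunct `BoundarySiteGraphConnected` of the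
skeleton — any two non-interior lattice sites of a finite `Λ` with connected complement
(`hexDomainSimplyConnected`) and connected induced subgraph are joined by steps across the
`𝕋`-edges dual to boundary darts `(v ∈ Λ, t ∉ Λ)`.  Bond–cycle duality through the winding-number
calculus of `HexSAWWinding` (`HV.wnd`, `HV.IsCyc.flux_eq_one`, `HV.wnd_left_sub_right`) and the
dual-edge dictionary `leftFace_rightFace` of `SAWDevelopingMapPotentialExistsTopology`:

* `exists_boundaryDart_at` — every non-interior lattice site carries a boundary dart;
* `dartSites_joined` — no dual edge is a bridge of the boundary-site graph (parity of the boundary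
  degrees, `even_card_dartsAt`, and double counting over a component);
* the theorem: were `p`, `q` not joined, a path `v_p ⇝ v_q` in `Λ` and a path `t_q ⇝ t_p` in `Λᶜ`
  close up to a simple cycle of `ℍ` through exactly two boundary darts; its winding number jumps
  across the dual edge of `t_p → v_p`, but is constant along the bridge-free chain from `p` to the
  other site of that edge — contradiction.
-/

noncomputable section

open Literature.Probability.LatticeModels Literature.Probability.RandomPlanarGeometry.SAW
open Literature.Barriers.CriticalPhenomena.HexGreen (nbrs mem_nbrs_iff)
open Literature.Barriers.CriticalPhenomena (HexKernel.face HexKernel.face_inj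
  HexKernel.mem_hexagonFaces_of_mem_hexFaceVertices)
open Summit.CriticalPhenomena.SAWScalingLimit.Theorems.PotentialExists (leftFace_rightFace)

namespace Summit.CriticalPhenomena.SAWScalingLimit.Theorems.PickHalfPlane.BoundaryExactness

variable {Λ : Finset HexVertex}

/-- **A boundary dart at every non-interior lattice site**: around the hexagon of a site carrying a
face of `Λ` and a face off `Λ`, two consecutive faces differ. [folklore] -/
theorem exists_boundaryDart_at {x : Site 2} (hx : IsLatticeSite Λ x) (hx' : ¬ IsInteriorSite Λ x) :
    ∃ v t : HexVertex, v ∈ Λ ∧ t ∉ Λ ∧ hexGraph.Adj v t ∧ x ∈ hexFaceVertices v ∧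
      x ∈ hexFaceVertices t := by
  classical
  obtain ⟨g, hg, hxg⟩ := hx
  obtain ⟨f, hxf, hf⟩ : ∃ f, x ∈ hexFaceVertices f ∧ f ∉ Λ := by
    by_contra h
    exact hx' fun f hf => by_contra fun hfΛ => h ⟨f, hf, hfΛ⟩
  obtain ⟨a, -, rfl⟩ := Finset.mem_image.1 (HexKernel.mem_hexagonFaces_of_mem_hexFaceVertices hxf)
  obtain ⟨b, -, rfl⟩ := Finset.mem_image.1 (HexKernel.mem_hexagonFaces_of_mem_hexFaceVertices hxg)
  by_contra hnone
  have hstep : ∀ k : Fin 6, HexKernel.face x k ∈ Λ → HexKernel.face x (k + 1) ∈ Λ := by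
    intro k hk
    by_contra hk1
    exact hnone ⟨_, _, hk, hk1, face_adj_face_succ x k, mem_hexFaceVertices_face x k,
      mem_hexFaceVertices_face x (k + 1)⟩
  have h1 := hstep _ hg
  have h2 := hstep _ h1
  have h3 := hstep _ h2
  have h4 := hstep _ h3
  have h5 := hstep _ h4
  have hall : ∀ j : Fin 6, HexKernel.face x (b + j) ∈ Λ := by
    intro j
    fin_cases j
    · simpa using hg
    · simpa using h1
    · convert h2 using 2
      rw [Fin.ext_iff]; simp [Fin.val_add]
    · convert h3 using 2
      rw [Fin.ext_iff]; simp [Fin.val_add]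
    · convert h4 using 2
      rw [Fin.ext_iff]; simp [Fin.val_add]
    · convert h5 using 2
      rw [Fin.ext_iff]; simp [Fin.val_add]
  have := hall (a - b)
  rw [add_sub_cancel] at this
  exact hf this

/-- **The other site of a dual edge**: the two faces of a boundary dart share exactly two
vertices. [folklore] -/
theorem exists_other_site {v t : HexVertex} (hvt : hexGraph.Adj v t) {p : Site 2}
    (hpv : p ∈ hexFaceVertices v) (hpt : p ∈ hexFaceVertices t) :
    ∃ p' : Site 2, p' ≠ p ∧ p' ∈ hexFaceVertices v ∧ p' ∈ hexFaceVertices t ∧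
      ∀ x, x ∈ hexFaceVertices v → x ∈ hexFaceVertices t → x = p ∨ x = p' := by
  obtain ⟨a, b, hab, hI⟩ := Finset.card_eq_two.1 ((hexGraph_adj_iff v t).1 hvt).2
  have hmem : ∀ x, x ∈ hexFaceVertices v → x ∈ hexFaceVertices t → x = a ∨ x = b := fun x hx hx' => by
    have : x ∈ hexFaceVertices v ∩ hexFaceVertices t := Finset.mem_inter.2 ⟨hx, hx'⟩
    rw [hI] at this
    simpa using this
  have hmem' : ∀ x, x = a ∨ x = b → x ∈ hexFaceVertices v ∧ x ∈ hexFaceVertices t := fun x hx => by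
    have : x ∈ hexFaceVertices v ∩ hexFaceVertices t := by rw [hI]; simpa using hx
    exact Finset.mem_inter.1 this
  rcases hmem p hpv hpt with rfl | rfl
  · exact ⟨b, hab.symm, (hmem' b (Or.inr rfl)).1, (hmem' b (Or.inr rfl)).2, hmem⟩
  · refine ⟨a, hab, (hmem' a (Or.inl rfl)).1, (hmem' a (Or.inl rfl)).2, fun x hx hx' => ?_⟩
    exact (hmem x hx hx').symm

/-- **No dual edge is a bridge of the boundary-site graph** (the general form of
`rootSites_joined`): the two sites of the dual edge of a boundary dart `(v₀, t₀)` are joined in the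
boundary-site graph WITHOUT that dart — parity of the boundary degrees (`even_card_dartsAt`) and
double counting over the component of one of them. [folklore] -/
theorem dartSites_joined {v₀ t₀ : HexVertex} (hv₀ : v₀ ∈ Λ) (ht₀ : t₀ ∉ Λ)
    (hvt₀ : hexGraph.Adj v₀ t₀) {p₀ p₁ : Site 2} (hp₀₁ : p₁ ≠ p₀) (hp₀v : p₀ ∈ hexFaceVertices v₀)
    (hp₀t : p₀ ∈ hexFaceVertices t₀) (hp₁v : p₁ ∈ hexFaceVertices v₀)
    (hp₁t : p₁ ∈ hexFaceVertices t₀)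
    (hsites : ∀ x, x ∈ hexFaceVertices v₀ → x ∈ hexFaceVertices t₀ → x = p₀ ∨ x = p₁) :
    Relation.ReflTransGen (fun p q : Site 2 => p ≠ q ∧ ∃ v ∈ Λ, ∃ t : HexVertex, t ∉ Λ ∧
        hexGraph.Adj v t ∧ (v, t) ≠ (v₀, t₀) ∧ p ∈ hexFaceVertices v ∧ p ∈ hexFaceVertices t ∧
        q ∈ hexFaceVertices v ∧ q ∈ hexFaceVertices t) p₀ p₁ := by
  classical
  set R' : Site 2 → Site 2 → Prop := fun p q => p ≠ q ∧ ∃ v ∈ Λ, ∃ t : HexVertex, t ∉ Λ ∧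
    hexGraph.Adj v t ∧ (v, t) ≠ (v₀, t₀) ∧ p ∈ hexFaceVertices v ∧ p ∈ hexFaceVertices t ∧
    q ∈ hexFaceVertices v ∧ q ∈ hexFaceVertices t with hR'
  by_contra hnot
  set S : Finset (Site 2) := Λ.biUnion hexFaceVertices with hS
  set C : Finset (Site 2) := S.filter fun x => Relation.ReflTransGen R' p₀ x with hC
  set D : Finset (HexVertex × HexVertex) :=
    (Λ ×ˢ Λ.biUnion nbrs).filter fun d => d.2 ∉ Λ ∧ hexGraph.Adj d.1 d.2 with hDdef
  have hD : ∀ d, d ∈ D ↔ d.1 ∈ Λ ∧ d.2 ∉ Λ ∧ hexGraph.Adj d.1 d.2 := by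
    intro d
    simp only [hDdef, Finset.mem_filter, Finset.mem_product, Finset.mem_biUnion, mem_nbrs_iff]
    exact ⟨fun ⟨⟨h1, _⟩, h2, h3⟩ => ⟨h1, h2, h3⟩, fun ⟨h1, h2, h3⟩ => ⟨⟨h1, d.1, h1, h3⟩, h2, h3⟩⟩
  set rd : HexVertex × HexVertex := (v₀, t₀) with hrd
  have hrdD : rd ∈ D := (hD rd).2 ⟨hv₀, ht₀, hvt₀⟩
  let inc : Site 2 → HexVertex × HexVertex → Prop := fun x d =>
    x ∈ hexFaceVertices d.1 ∧ x ∈ hexFaceVertices d.2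
  have hinc_rd : ∀ x, inc x rd ↔ x = p₀ ∨ x = p₁ := fun x =>
    ⟨fun h => hsites x h.1 h.2, by rintro (rfl | rfl) <;> [exact ⟨hp₀v, hp₀t⟩; exact ⟨hp₁v, hp₁t⟩]⟩
  have hA : p₀ ∈ C :=
    Finset.mem_filter.2 ⟨Finset.mem_biUnion.2 ⟨_, hv₀, hp₀v⟩, Relation.ReflTransGen.refl⟩
  have hA' : p₁ ∉ C := fun h => hnot (Finset.mem_filter.1 h).2
  have hclos : ∀ d ∈ D, d ≠ rd → ∀ x y, inc x d → inc y d → x ∈ C → y ∈ C := by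
    intro d hd hdr x y hx hy hxC
    by_cases hxy : x = y
    · rwa [← hxy]
    obtain ⟨hv, ht, hadj⟩ := (hD d).1 hd
    refine Finset.mem_filter.2 ⟨Finset.mem_biUnion.2 ⟨d.1, hv, hy.1⟩,
      (Finset.mem_filter.1 hxC).2.tail ⟨hxy, d.1, hv, d.2, ht, hadj, hdr, hx.1, hx.2, hy.1, hy.2⟩⟩
  have heven1 : Even (∑ x ∈ C, ((D.erase rd).filter (inc x)).card) := by
    have hdc : ∑ x ∈ C, ((D.erase rd).filter (inc x)).card =
        ∑ d ∈ D.erase rd, (C.filter fun x => inc x d).card := by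
      simp only [Finset.card_filter]
      exact Finset.sum_comm
    rw [hdc]
    refine Finset.even_sum _ fun d hd => ?_
    obtain ⟨hdr, hdD⟩ := Finset.mem_erase.1 hd
    by_cases h0 : ∃ x ∈ C, inc x d
    · obtain ⟨x, hxC, hx⟩ := h0
      have e : (C.filter fun y => inc y d) = hexFaceVertices d.1 ∩ hexFaceVertices d.2 := by
        ext y
        simp only [Finset.mem_filter, Finset.mem_inter]
        exact ⟨fun h => h.2, fun h => ⟨hclos d hdD hdr x y hx h hxC, h⟩⟩
      rw [e, ((hexGraph_adj_iff _ _).1 ((hD d).1 hdD).2.2).2]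
      exact ⟨1, rfl⟩
    · rw [Finset.filter_eq_empty_iff.2 fun y hy hyd => h0 ⟨y, hy, hyd⟩]
      exact ⟨0, rfl⟩
  have hsite : ∀ x, ((D.erase rd).filter (inc x)).card +
      (if x = p₀ ∨ x = p₁ then 1 else 0) = (D.filter (inc x)).card := by
    intro x
    rw [Finset.filter_erase]
    by_cases hx : x = p₀ ∨ x = p₁
    · rw [if_pos hx]
      exact Finset.card_erase_add_one (Finset.mem_filter.2 ⟨hrdD, (hinc_rd x).2 hx⟩)
    · rw [if_neg hx, add_zero, Finset.erase_eq_of_notMem]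
      exact fun h => hx ((hinc_rd x).1 (Finset.mem_filter.1 h).2)
  have hsum : ∑ x ∈ C, ((D.erase rd).filter (inc x)).card +
      (C.filter fun x => x = p₀ ∨ x = p₁).card = ∑ x ∈ C, (D.filter (inc x)).card := by
    rw [Finset.card_filter, ← Finset.sum_add_distrib]
    exact Finset.sum_congr rfl fun x _ => hsite x
  have hone : (C.filter fun x => x = p₀ ∨ x = p₁).card = 1 := by
    rw [Finset.card_eq_one]
    refine ⟨p₀, ?_⟩
    ext x
    simp only [Finset.mem_filter, Finset.mem_singleton]
    constructor
    · rintro ⟨hxC, rfl | rfl⟩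
      · rfl
      · exact absurd hxC hA'
    · rintro rfl
      exact ⟨hA, Or.inl rfl⟩
  have heven2 : Even (∑ x ∈ C, (D.filter (inc x)).card) :=
    Finset.even_sum _ fun x _ => even_card_dartsAt x D hD
  rw [← hsum, hone, Nat.even_add_one] at heven2
  exact heven2 heven1


/-! ### The global argument: one boundary component -/

/-- **Registered sub-goal `stub_halfPlaneInputs_boundarySiteGraphConnected`** (crux
stmt-CriticalPhenomena-14004, line `pick-half-plane`, serving `stub_halfPlaneInputs`, wave 6):
**the boundary-site graph of a simply connected, connected hexagonal domain is connected** — any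
two non-interior lattice sites are joined by a chain of steps across the `𝕋`-edges dual to boundary
darts.  Bond–cycle duality by winding numbers: if `p` and `q` were not joined, take boundary darts
`(v_p, t_p)` at `p` and `(v_q, t_q)` at `q`, a path `v_p ⇝ v_q` inside `Λ` (connectivity) and a
path `t_q ⇝ t_p` inside `Λᶜ` (simple connectivity); together they form a simple cycle `ℓ` of `ℍ`
through exactly two boundary darts.  The winding number of `ℓ` about a lattice site jumps by `1`
across the dual edge of the dart `t_p → v_p` (`HV.IsCyc.flux_eq_one`), i.e. between `p` and the
other site `p̄` of that edge, while it is unchanged across the dual edge of every other boundary dart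
off `{v_q, t_q}` (no flux).  But `p` and `p̄` are joined in the boundary-site graph WITHOUT the dart
`(v_p, t_p)` (`dartSites_joined`, parity), by a chain that never uses the dart `(v_q, t_q)` either
(it would reach `q`): contradiction. [folklore] -/
theorem stub_halfPlaneInputs_boundarySiteGraphConnected :
    ∀ (Λ : Finset HexVertex), hexDomainSimplyConnected Λ →
      (hexGraph.induce ((Λ : Finset HexVertex) : Set HexVertex)).Preconnected →
      ∀ (p q : Site 2), IsLatticeSite Λ p → ¬ IsInteriorSite Λ p →
        IsLatticeSite Λ q → ¬ IsInteriorSite Λ q →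
        Relation.ReflTransGen (fun a b : Site 2 => a ≠ b ∧ ∃ v ∈ Λ, ∃ t : HexVertex, t ∉ Λ ∧
          hexGraph.Adj v t ∧ a ∈ hexFaceVertices v ∧ a ∈ hexFaceVertices t ∧
          b ∈ hexFaceVertices v ∧ b ∈ hexFaceVertices t) p q := by
  classical
  intro Λ hΛ hpre p q hp hp' hq hq'
  set R : Site 2 → Site 2 → Prop := fun a b => a ≠ b ∧ ∃ v ∈ Λ, ∃ t : HexVertex, t ∉ Λ ∧
    hexGraph.Adj v t ∧ a ∈ hexFaceVertices v ∧ a ∈ hexFaceVertices t ∧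
    b ∈ hexFaceVertices v ∧ b ∈ hexFaceVertices t with hR
  by_contra hnot
  -- boundary darts at `p` and `q`, and the other sites of their dual edges
  obtain ⟨vp, tp, hvp, htp, hadjp, hpv, hpt⟩ := exists_boundaryDart_at hp hp'
  obtain ⟨vq, tq, hvq, htq, hadjq, hqv, hqt⟩ := exists_boundaryDart_at hq hq'
  obtain ⟨p', hp'p, hp'v, hp't, hsites_p⟩ := exists_other_site hadjp hpv hpt
  obtain ⟨q', hq'q, hq'v, hq't, hsites_q⟩ := exists_other_site hadjq hqv hqt
  have hRpp' : R p p' := ⟨hp'p.symm, vp, hvp, tp, htp, hadjp, hpv, hpt, hp'v, hp't⟩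
  have hRq'q : R q' q := ⟨hq'q, vq, hvq, tq, htq, hadjq, hq'v, hq't, hqv, hqt⟩
  have hnq' : ¬ Relation.ReflTransGen R p q' := fun h => hnot (h.tail hRq'q)
  -- the two paths and the cycle of `ℍ`
  obtain ⟨PΛ⟩ := hpre ⟨vp, by simpa using hvp⟩ ⟨vq, by simpa using hvq⟩
  obtain ⟨Pc⟩ := hΛ ⟨tq, by simpa using htq⟩ ⟨tp, by simpa using htp⟩
  set A : List HV := PΛ.bypass.support.map fun z => toHV z.1 with hA
  set M : List HV := Pc.bypass.support.map fun z => toHV z.1 with hM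
  set l : List HV := A ++ M with hl
  have htoHV : Function.Injective toHV := fun a b h => by simpa using congrArg ofHV h
  have hAne : A ≠ [] := by simp [hA]
  have hMne : M ≠ [] := by simp [hM]
  have hAhead : A.head hAne = toHV vp := by
    have : A = toHV vp :: (PΛ.bypass.support.tail.map fun z => toHV z.1) := by
      rw [hA, ← PΛ.bypass.cons_tail_support]; rfl
    simp only [this, List.head_cons]
  have hAlast : A.getLast hAne = toHV vq := by
    simp only [hA, List.getLast_map, SimpleGraph.Walk.getLast_support]
  have hMhead : M.head hMne = toHV tq := by
    have : M = toHV tq :: (Pc.bypass.support.tail.map fun z => toHV z.1) := by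
      rw [hM, ← Pc.bypass.cons_tail_support]; rfl
    simp only [this, List.head_cons]
  have hMlast : M.getLast hMne = toHV tp := by
    simp only [hM, List.getLast_map, SimpleGraph.Walk.getLast_support]
  have hmemA : ∀ z ∈ A, ∃ y : HexVertex, y ∈ Λ ∧ toHV y = z := by
    intro z hz
    rw [hA, List.mem_map] at hz
    obtain ⟨u, -, rfl⟩ := hz
    have hu := u.2
    rw [Finset.mem_coe] at hu
    exact ⟨u.1, hu, rfl⟩
  have hmemM : ∀ z ∈ M, ∃ y : HexVertex, y ∉ Λ ∧ toHV y = z := by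
    intro z hz
    rw [hM, List.mem_map] at hz
    obtain ⟨u, -, rfl⟩ := hz
    have hu := u.2
    rw [Set.mem_compl_iff, Finset.mem_coe] at hu
    exact ⟨u.1, hu, rfl⟩
  have hAΛ : ∀ y : HexVertex, toHV y ∈ A → y ∈ Λ := fun y hy => by
    obtain ⟨y', hy', he⟩ := hmemA _ hy
    exact htoHV he ▸ hy'
  have hMΛ : ∀ y : HexVertex, toHV y ∈ M → y ∉ Λ := fun y hy => by
    obtain ⟨y', hy', he⟩ := hmemM _ hy
    exact htoHV he ▸ hy'
  have hchA : A.IsChain hvGraph.Adj := by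
    rw [hA, List.isChain_map]
    exact List.IsChain.imp (fun a b h => (hexGraph_adj_iff_hvGraph_adj _ _).1 h)
      PΛ.bypass.isChain_adj_support
  have hchM : M.IsChain hvGraph.Adj := by
    rw [hM, List.isChain_map]
    exact List.IsChain.imp (fun a b h => (hexGraph_adj_iff_hvGraph_adj _ _).1 h)
      Pc.bypass.isChain_adj_support
  have hndA : A.Nodup := by
    rw [hA]; exact PΛ.bypass_isPath.support_nodup.map (htoHV.comp Subtype.val_injective)
  have hndM : M.Nodup := by
    rw [hM]; exact Pc.bypass_isPath.support_nodup.map (htoHV.comp Subtype.val_injective)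
  -- the darts of the cycle
  have hcd : ∀ d ∈ HV.cdarts l, d ∈ HV.pdarts A ∨ d = (toHV vq, toHV tq) ∨ d ∈ HV.pdarts M ∨
      d = (toHV tp, toHV vp) := by
    intro d hd
    rw [hl, HV.cdarts_append A M hAne hMne, hAlast, hMhead, hMlast, hAhead] at hd
    simp only [List.mem_append, List.mem_cons] at hd
    tauto
  have hadj : ∀ d ∈ HV.cdarts l, hvGraph.Adj d.1 d.2 := by
    intro d hd
    rcases hcd d hd with h | rfl | h | rfl
    · exact HV.adj_of_mem_pdarts hchA d h
    · exact (hexGraph_adj_iff_hvGraph_adj _ _).1 hadjq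
    · exact HV.adj_of_mem_pdarts hchM d h
    · exact (hexGraph_adj_iff_hvGraph_adj _ _).1 hadjp.symm
  have hnd : l.Nodup := by
    rw [hl]
    refine List.nodup_append.2 ⟨hndA, hndM, fun z hz z' hz' hzz' => ?_⟩
    obtain ⟨y, hy, rfl⟩ := hmemA z hz
    subst hzz'
    exact hMΛ y hz' hy
  have hlen : 3 ≤ l.length := by
    by_contra hlt
    have hA1 : A.length = 1 := by
      have h1 : 1 ≤ A.length := List.length_pos_of_ne_nil hAne
      have h2 : 1 ≤ M.length := List.length_pos_of_ne_nil hMne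
      have : l.length = A.length + M.length := by rw [hl, List.length_append]
      omega
    have hM1 : M.length = 1 := by
      have h1 : 1 ≤ A.length := List.length_pos_of_ne_nil hAne
      have h2 : 1 ≤ M.length := List.length_pos_of_ne_nil hMne
      have : l.length = A.length + M.length := by rw [hl, List.length_append]
      omega
    obtain ⟨a, ha⟩ := List.length_eq_one_iff.1 hA1
    obtain ⟨b, hb⟩ := List.length_eq_one_iff.1 hM1
    have hvpq : vp = vq := htoHV (by
      rw [← hAhead, ← hAlast]; simp only [ha, List.head_cons, List.getLast_singleton])
    have htpq : tq = tp := htoHV (by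
      rw [← hMhead, ← hMlast]; simp only [hb, List.head_cons, List.getLast_singleton])
    rw [← hvpq] at hqv
    rw [htpq] at hqt
    rcases hsites_p q hqv hqt with rfl | rfl
    · exact hnot Relation.ReflTransGen.refl
    · exact hnot (Relation.ReflTransGen.single hRpp')
  have hcyc : HV.IsCyc l := ⟨hlen, hnd, hadj⟩
  -- the winding number around a site, and its jump across the dual edge of `t_p → v_p`
  set W : Site 2 → ℤ := fun s => HV.wnd l (s 0, s 1) with hW
  have hjump : W p ≠ W p' := by
    have hmem : (toHV tp, toHV vp) ∈ HV.cdarts l := by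
      rw [hl, HV.cdarts_append A M hAne hMne, hMlast, hAhead]; simp
    have h := HV.wnd_left_sub_right hadj ((hexGraph_adj_iff_hvGraph_adj _ _).1 hadjp.symm)
    rw [hcyc.flux_eq_one hmem] at h
    rcases leftFace_rightFace hadjp.symm hpt hpv hp't hp'v hp'p.symm with ⟨h1, h2⟩ | ⟨h1, h2⟩
    · rw [h1, h2] at h; change W p - W p' = 1 at h; omega
    · rw [h1, h2] at h; change W p' - W p = 1 at h; omega
  -- along the chain from `p` to `p'` avoiding the dart `(v_p, t_p)` the winding number is constant
  have hconst : ∀ z, Relation.ReflTransGen (fun a b : Site 2 => a ≠ b ∧ ∃ v ∈ Λ, ∃ t : HexVertex,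
      t ∉ Λ ∧ hexGraph.Adj v t ∧ (v, t) ≠ (vp, tp) ∧ a ∈ hexFaceVertices v ∧
      a ∈ hexFaceVertices t ∧ b ∈ hexFaceVertices v ∧ b ∈ hexFaceVertices t) p z →
      Relation.ReflTransGen R p z ∧ W z = W p := by
    intro z hz
    induction hz with
    | refl => exact ⟨Relation.ReflTransGen.refl, rfl⟩
    | @tail a b _ hab ih =>
      obtain ⟨hne, v, hv, t, ht, hvt, hvt_ne, hav, hat, hbv, hbt⟩ := hab
      have hreach : Relation.ReflTransGen R p b :=
        ih.1.tail ⟨hne, v, hv, t, ht, hvt, hav, hat, hbv, hbt⟩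
      refine ⟨hreach, ?_⟩
      by_cases hqd : (v, t) = (vq, tq)
      · obtain ⟨rfl, rfl⟩ := Prod.mk.inj hqd
        rcases hsites_q b hbv hbt with rfl | rfl
        · exact absurd hreach hnot
        · exact absurd hreach hnq'
      · have hflux : HV.flux l (toHV v) (toHV t) = 0 := by
          rw [HV.flux, HV.dcount_eq_zero_of_not_mem_cdarts, HV.dcount_eq_zero_of_not_mem_cdarts]
          · simp
          · intro hmem
            rcases hcd _ hmem with h | h | h | h
            · exact ht (hAΛ t (HV.mem_of_mem_pdarts h).1)
            · obtain ⟨h1, -⟩ := Prod.mk.inj h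
              exact ht (htoHV h1 ▸ hvq)
            · exact hMΛ v (HV.mem_of_mem_pdarts h).2 hv
            · obtain ⟨h1, h2⟩ := Prod.mk.inj h
              exact hvt_ne (Prod.ext (htoHV h2) (htoHV h1))
          · intro hmem
            rcases hcd _ hmem with h | h | h | h
            · exact ht (hAΛ t (HV.mem_of_mem_pdarts h).2)
            · obtain ⟨h1, h2⟩ := Prod.mk.inj h
              exact hqd (Prod.ext (htoHV h1) (htoHV h2))
            · exact hMΛ v (HV.mem_of_mem_pdarts h).1 hv
            · obtain ⟨h1, -⟩ := Prod.mk.inj h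
              exact htp (htoHV h1 ▸ hv)
        have h0 := HV.wnd_left_eq_right hadj ((hexGraph_adj_iff_hvGraph_adj _ _).1 hvt) hflux
        rcases leftFace_rightFace hvt hav hat hbv hbt hne with ⟨h1, h2⟩ | ⟨h1, h2⟩
        · rw [h1, h2] at h0
          change W a = W b at h0
          exact h0.symm.trans ih.2
        · rw [h1, h2] at h0
          change W b = W a at h0
          exact h0.trans ih.2
  exact hjump ((hconst p' (dartSites_joined hvp htp hadjp hp'p hpv hpt hp'v hp't hsites_p)).2).symm


end Summit.CriticalPhenomena.SAWScalingLimit.Theorems.PickHalfPlane.BoundaryExactness
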